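import Summits.Ventures.HSemireg.EmbeddedFirstOrderDeformationsRestriction

/-!
# Venture HSemireg — the ČECH OBSTRUCTION to lifting a closed subscheme across a flat first-order thickening of a
# NON-affine ambient presented by a thickened atlas (Hartshorne, *Deformation Theory*, Thm. 6.2 (b); the Čech sentence
# of PROPOSITION K «`Z` lifts ⟺ the cochain of local differences is a coboundary»)

HONEST FRAMING.  Lean side of the computation cell `pub-hsemireg` (track «S4-PUSH» (ii), seat s4-prove-3 g5, second
route for (S5)); log `s4push/prove-3/ATTEMPT-9.md` (file II).  Plain commutative algebra over an ABSTRACT THICKENED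
ATLAS: charts `π_α : A'_α ↠ A_α` (parameter `e_α`), overlap thickenings `π_αβ : A'_αβ ↠ A_αβ`, restriction maps
`ρˡ_αβ : A'_α → A'_αβ`, `ρʳ_αβ : A'_β → A'_αβ` that are morphisms of thickenings CARRYING FLAT LIFTS TO FLAT LIFTS
(`…Restriction`: discharged for localisations and transition isomorphisms), and a closed subscheme `Z = (I_α)` with
overlap ideals `I_αβ`; NO global ring (so — unlike the affine setting of `…LiftGluing`, where every ideal lifts — the
criterion below is not empty).  No Mathlib scheme, sheaf, Čech-to-derived comparison `Ȟ¹(𝔘, 𝒩) → H¹(Z, 𝒩)`, abelian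
variety or semiregularity map is constructed; nothing here says that HC, HC_CM or HC_AV holds; no object is certified;
no Literature fact is declared.

WHAT (namespace `Summit.Ventures.HSemireg.EmbeddedDeformation`; `𝔄 : ThickenedAtlas …` the hypotheses, `T_α` any
chosen local flat lifts — «extensions of `Y` over `C'` exist locally»):
* `IsAtlasLift K` — a LIFT OF `Z` TO THE THICKENED ATLAS: local flat lifts `K_α` with `K_α|_{αβ} = K_β|_{αβ}` (a closed
  subscheme `Z' ⊂ X'` flat over `D` with `Z' ×_D k = Z`, by the sheaf property);
* `cechCochain 𝔄 hT α β := T_β|_{αβ} − T_α|_{αβ} ∈ Hom(I_αβ, A_αβ/I_αβ)` — Hartshorne's `α_ij` («by part (a) these define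
  an element `α_ij ∈ H⁰(U_ij, 𝒩₀ ⊗ J)`»);
* **`exists_isAtlasLift_iff`** (Thm. 6.2 (b)): `(∃ K, IsAtlasLift K) ↔ ∃ φ, ∀ α β, cechCochain α β = φ_β| − φ_α|` —
  `Z` lifts iff the Čech cochain is a COBOUNDARY («`α_ij = β_j − β_i` … modify the choices … which then glue»; «if
  `Y'` exists … `α_ij = 0`»);
* **`cechCochain_translate`** — other choices `T_α + χ_α` change the cochain by the coboundary of `χ`
  («`α''_ij = α_ij + β_j − β_i`, so the cohomology class is well-defined»);
* **`cechCochain_cocycle`** — on triple-overlap data the cochain is a 1-COCYCLE («`α_ik = α_ij + α_jk`»);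
* **`IsAtlasLift.translate` / `IsAtlasLift.diff_cocycle` / `atlasLiftEquiv`** — given one lift of `Z`, the lifts of `Z`
  are a TORSOR under the Čech 0-cocycles `{ψ : ψ_α| = ψ_β|}` = `Ȟ⁰(𝔘, 𝒩)` (Thm. 6.2 (b), last sentence).
With `…SmoothSplitting` (local sections `σ_α` ⇒ `T_α = σ_α(I_α)A'_α`, transitions = twists by `θ_αβ`) the cochain is
`θ̄_αβ|_{I_αβ}` (`diff_map_section`) — Prop. K's cochain literally; that corollary is a two-line sequel once both files
are built.  NOT typed here: Čech cohomology of the atlas vs. sheaf cohomology `H¹(Z, 𝒩_{Z/X})`, refinement of covers,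
the identification of a Mathlib scheme with an atlas.

References: R. Hartshorne, *Deformation Theory*, GTM 257 (2010), §6 Thm. 6.2 (b) and its proof [corpus:
book:springernd-deformation-theory p0054 (statement) / p0056 (proof)].
-/

namespace Summit.Ventures.HSemireg

namespace EmbeddedDeformation

universe w u v u' v' u'' v''

/-! ### §0 Two torsor identities on one thickening -/

section OneThickening

variable {R' : Type u} {R : Type v} [CommRing R'] [CommRing R] {π : R' →+* R} {e : R'} {I : Ideal R}
variable {J₁ J₁' J₂ J₂' : Ideal R'}

/-- The difference of two flat lifts depends only on the two ideals (proof-irrelevance bookkeeping). [folklore] -/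
theorem IsLift.diff_congr (hT : IsFirstOrderThickening π e) (h₁ : IsLift π e I J₁) (h₂ : IsLift π e I J₂)
    (h₁' : IsLift π e I J₁') (h₂' : IsLift π e I J₂') (e₁ : J₁ = J₁') (e₂ : J₂ = J₂') :
    h₁.diff hT h₂ = h₁'.diff hT h₂' := by
  subst e₁ e₂
  rfl

/-- **`(J₂ + φ₂) − (J₁ + φ₁) = (J₂ − J₁) + φ₂ − φ₁`** (cocycle identity + `(J + φ) − J = φ`). [cite: Hartshorne2010,
§6 proof of Thm. 6.2 («`α''_ij = α_ij + β_j − β_i`»)] -/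
theorem diff_translate_translate (hT : IsFirstOrderThickening π e) (h₁ : IsLift π e I J₁) (h₂ : IsLift π e I J₂)
    (φ₁ φ₂ : I →ₗ[R] R ⧸ I) :
    (isLift_translate hT h₁ φ₁).diff hT (isLift_translate hT h₂ φ₂) = h₁.diff hT h₂ + φ₂ - φ₁ := by
  have ht₁ := isLift_translate hT h₁ φ₁
  have ht₂ := isLift_translate hT h₂ φ₂
  rw [← ht₁.diff_add_diff hT h₁ ht₂, ← h₁.diff_add_diff hT h₂ ht₂, diff_translate hT h₂ φ₂, h₁.diff_comm hT ht₁,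
    diff_translate hT h₁ φ₁]
  abel

end OneThickening

/-! ### §1 Thickened atlases, lifts of a subscheme to the atlas, the Čech cochain -/

section Atlas

variable {ι : Type w}
variable {A' : ι → Type u} {A : ι → Type v} [∀ α, CommRing (A' α)] [∀ α, CommRing (A α)]
variable {A'₂ : ι → ι → Type u'} {A₂ : ι → ι → Type v'} [∀ α β, CommRing (A'₂ α β)] [∀ α β, CommRing (A₂ α β)]

/-- **A thickened atlas with a closed subscheme** (all hypotheses of Thm. 6.2 (b), atlas form): flat first-order
thickenings `π_α : A'_α ↠ A_α` (charts `U'_α` of `X'` over charts `U_α` of `X`) and `π_αβ : A'_αβ ↠ A_αβ` (overlaps),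
restriction morphisms of thickenings `ρˡ_αβ : A'_α → A'_αβ` over `rˡ_αβ` and `ρʳ_αβ : A'_β → A'_αβ` over `rʳ_αβ`, and a
closed subscheme `Z`: ideals `I_α ⊆ A_α`, `I_αβ ⊆ A_αβ`, such that BOTH restrictions carry flat lifts of `I_α`
(resp. `I_β`) to flat lifts of `I_αβ` (then `I_α·A_αβ = I_αβ = I_β·A_αβ` as soon as local lifts exist,
`PreservesLifts.map_eq`).  Instances: basic-open overlaps of affine charts (`preservesLifts_localization`) composed
with transition isomorphisms (`preservesLifts_ringEquiv`). [cite: Hartshorne2010, §6 Thm. 6.2 (setting)] -/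
structure ThickenedAtlas (π : ∀ α, A' α →+* A α) (e : ∀ α, A' α) (π₂ : ∀ α β, A'₂ α β →+* A₂ α β)
    (e₂ : ∀ α β, A'₂ α β) (ρl : ∀ α β, A' α →+* A'₂ α β) (rl : ∀ α β, A α →+* A₂ α β)
    (ρr : ∀ α β, A' β →+* A'₂ α β) (rr : ∀ α β, A β →+* A₂ α β) (I : ∀ α, Ideal (A α))
    (I₂ : ∀ α β, Ideal (A₂ α β)) : Prop where
  /-- each chart thickening is a flat first-order thickening -/
  thick : ∀ α, IsFirstOrderThickening (π α) (e α)
  /-- each overlap thickening is a flat first-order thickening -/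
  thick₂ : ∀ α β, IsFirstOrderThickening (π₂ α β) (e₂ α β)
  /-- `ρˡ_αβ` is a morphism of thickenings over `rˡ_αβ` -/
  homl : ∀ α β, IsThickeningHom (π α) (e α) (π₂ α β) (e₂ α β) (ρl α β) (rl α β)
  /-- `ρʳ_αβ` is a morphism of thickenings over `rʳ_αβ` -/
  homr : ∀ α β, IsThickeningHom (π β) (e β) (π₂ α β) (e₂ α β) (ρr α β) (rr α β)
  /-- `ρˡ_αβ` carries flat lifts of `I_α` to flat lifts of `I_αβ` -/
  liftsl : ∀ α β, PreservesLifts (π α) (e α) (π₂ α β) (e₂ α β) (ρl α β) (I α) (I₂ α β)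
  /-- `ρʳ_αβ` carries flat lifts of `I_β` to flat lifts of `I_αβ` -/
  liftsr : ∀ α β, PreservesLifts (π β) (e β) (π₂ α β) (e₂ α β) (ρr α β) (I β) (I₂ α β)

variable {π : ∀ α, A' α →+* A α} {e : ∀ α, A' α} {π₂ : ∀ α β, A'₂ α β →+* A₂ α β} {e₂ : ∀ α β, A'₂ α β}
variable {ρl : ∀ α β, A' α →+* A'₂ α β} {rl : ∀ α β, A α →+* A₂ α β}
variable {ρr : ∀ α β, A' β →+* A'₂ α β} {rr : ∀ α β, A β →+* A₂ α β}
variable {I : ∀ α, Ideal (A α)} {I₂ : ∀ α β, Ideal (A₂ α β)}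

/-- **A lift of `Z` to the thickened atlas** («an extension `Y' ⊆ X'` of `Y` over `C'`», for `X'` given by an atlas):
flat lifts `K_α` of `I_α` to every chart thickening that AGREE ON OVERLAPS, `K_α·A'_αβ = K_β·A'_αβ`.
[cite: Hartshorne2010, §6 Thm. 6.2 (b)] -/
structure IsAtlasLift (π : ∀ α, A' α →+* A α) (e : ∀ α, A' α) (ρl : ∀ α β, A' α →+* A'₂ α β)
    (ρr : ∀ α β, A' β →+* A'₂ α β) (I : ∀ α, Ideal (A α)) (K : ∀ α, Ideal (A' α)) : Prop where
  /-- each `K_α` is a flat lift of `I_α` -/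
  isLift : ∀ α, IsLift (π α) (e α) (I α) (K α)
  /-- the local lifts agree on overlaps -/
  compat : ∀ α β, (K α).map (ρl α β) = (K β).map (ρr α β)

variable (𝔄 : ThickenedAtlas π e π₂ e₂ ρl rl ρr rr I I₂) {T : ∀ α, Ideal (A' α)}
variable (hT : ∀ α, IsLift (π α) (e α) (I α) (T α))

/-- **The Čech cochain of the chosen local lifts** `T_α`: `c_αβ := T_β|_{αβ} − T_α|_{αβ} ∈ Hom(I_αβ, A_αβ/I_αβ)` —
Hartshorne's `α_ij`, the element of `H⁰(U_ij, 𝒩)` defined via part (a) by the two extensions `Y'_i ∩ U'_ij`,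
`Y'_j ∩ U'_ij`. [cite: Hartshorne2010, §6 proof of Thm. 6.2 (b)] -/
noncomputable def cechCochain (α β : ι) : I₂ α β →ₗ[A₂ α β] A₂ α β ⧸ I₂ α β :=
  (𝔄.liftsl α β (hT α)).diff (𝔄.thick₂ α β) (𝔄.liftsr α β (hT β))

/-- Restriction of normal vectors from the chart `α` to the overlap `αβ` (along `ρˡ_αβ`): `φ ↦ φ|_{αβ}`
(`…Restriction`, `resNormal`; it is the base change `φ|(rˡ x) = rˡ(φ x)` and is independent of the base lift).
[cite: Hartshorne2010, §6 proof of Thm. 6.2] -/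
noncomputable def resL (α β : ι) (φ : I α →ₗ[A α] A α ⧸ I α) : I₂ α β →ₗ[A₂ α β] A₂ α β ⧸ I₂ α β :=
  resNormal (𝔄.thick α) (𝔄.thick₂ α β) (𝔄.liftsl α β) (hT α) φ

/-- Restriction of normal vectors from the chart `β` to the overlap `αβ` (along `ρʳ_αβ`).
[cite: Hartshorne2010, §6 proof of Thm. 6.2] -/
noncomputable def resR (α β : ι) (φ : I β →ₗ[A β] A β ⧸ I β) : I₂ α β →ₗ[A₂ α β] A₂ α β ⧸ I₂ α β :=
  resNormal (𝔄.thick β) (𝔄.thick₂ α β) (𝔄.liftsr α β) (hT β) φ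

/-! ### §2 Theorem 6.2 (b): `Z` lifts to the atlas iff the Čech cochain is a coboundary -/

/-- **HARTSHORNE THM. 6.2 (b), atlas form (PROPOSITION K's Čech sentence).**  Let local flat lifts `T_α` of `Z` exist
on every chart.  Then `Z` LIFTS TO THE THICKENED ATLAS (a compatible family of local flat lifts exists) IF AND ONLY IF
the Čech cochain `(c_αβ) = (T_β| − T_α|)` is a COBOUNDARY: `c_αβ = φ_β|_{αβ} − φ_α|_{αβ}` for some normal vectors
`φ_α ∈ Hom(I_α, A_α/I_α)`.  (⇐): the modified choices `T_α − φ_α` agree on overlaps, since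
`(T_β − φ_β)| − (T_α − φ_α)| = c_αβ − φ_β| + φ_α| = 0` and the action on lifts is free; (⇒): for a lift `K`,
`φ_α := T_α − K_α` has coboundary `(T_β| − K_β|) − (T_α| − K_α|) = T_β| − T_α|` because `K_α| = K_β|`.
[cite: Hartshorne2010, §6 Thm. 6.2 (b)] -/
theorem exists_isAtlasLift_iff :
    (∃ K : ∀ α, Ideal (A' α), IsAtlasLift π e ρl ρr I K) ↔
      ∃ φ : ∀ α, I α →ₗ[A α] A α ⧸ I α,
        ∀ α β, cechCochain 𝔄 hT α β = resR 𝔄 hT α β (φ β) - resL 𝔄 hT α β (φ α) := by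
  constructor
  · rintro ⟨K, hK⟩
    refine ⟨fun α ↦ (hK.isLift α).diff (𝔄.thick α) (hT α), fun α β ↦ ?_⟩
    have hKl := 𝔄.liftsl α β (hK.isLift α)
    have hKr := 𝔄.liftsr α β (hK.isLift β)
    have hTl := 𝔄.liftsl α β (hT α)
    have hTr := 𝔄.liftsr α β (hT β)
    rw [resR, resL, ← diff_map_eq_resNormal (𝔄.thick α) (𝔄.thick₂ α β) (𝔄.homl α β) (𝔄.liftsl α β) (hT α)
        (hK.isLift α) (hT α), ← diff_map_eq_resNormal (𝔄.thick β) (𝔄.thick₂ α β) (𝔄.homr α β) (𝔄.liftsr α β)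
        (hT β) (hK.isLift β) (hT β), cechCochain,
      hKr.diff_congr (𝔄.thick₂ α β) hTr hKl hTr (hK.compat α β).symm rfl,
      ← hKl.diff_add_diff (𝔄.thick₂ α β) hTl hTr]
    abel
  · rintro ⟨φ, hφ⟩
    refine ⟨fun α ↦ translate (π α) (e α) (T α) (I α) (-φ α),
      fun α ↦ isLift_translate (𝔄.thick α) (hT α) (-φ α), fun α β ↦ ?_⟩
    have hTl := 𝔄.liftsl α β (hT α)
    have hTr := 𝔄.liftsr α β (hT β)
    rw [map_translate (𝔄.thick α) (𝔄.thick₂ α β) (𝔄.homl α β) (𝔄.liftsl α β) (hT α) (hT α),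
      map_translate (𝔄.thick β) (𝔄.thick₂ α β) (𝔄.homr α β) (𝔄.liftsr α β) (hT β) (hT β)]
    refine ((isLift_translate (𝔄.thick₂ α β) hTl _).eq_of_diff_eq_zero (𝔄.thick₂ α β)
      (isLift_translate (𝔄.thick₂ α β) hTr _) ?_).symm
    rw [diff_translate_translate (𝔄.thick₂ α β) hTl hTr, resNormal_neg (𝔄.homl α β) (𝔄.liftsl α β) (hT α),
      resNormal_neg (𝔄.homr α β) (𝔄.liftsr α β) (hT β)]
    have h := hφ α β
    rw [cechCochain, resR, resL] at h
    rw [h]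
    abel

/-- (⇒) in words: if `Z` lifts to the atlas then, computing the cochain with the restrictions of a lift as the local
choices, `c_αβ = 0` («if `Y'` exists, we can take `Y'_i = Y' ∩ U'_i`; then `α_ij = 0`»). [cite: Hartshorne2010,
§6 proof of Thm. 6.2 (b)] -/
theorem cechCochain_eq_zero_of_isAtlasLift {K : ∀ α, Ideal (A' α)} (hK : IsAtlasLift π e ρl ρr I K) (α β : ι) :
    cechCochain 𝔄 hK.isLift α β = 0 := by
  have hKl := 𝔄.liftsl α β (hK.isLift α)
  have hKr := 𝔄.liftsr α β (hK.isLift β)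
  rw [cechCochain, hKl.diff_congr (𝔄.thick₂ α β) hKr hKr hKr (hK.compat α β) rfl, hKr.diff_self]

/-! ### §3 The class does not depend on the local choices; the cochain is a cocycle -/

/-- **Change of local choices changes the cochain by a coboundary**: with `T'_α := T_α + χ_α`,
`c'_αβ = c_αβ + χ_β|_{αβ} − χ_α|_{αβ}` («`α''_ij = α_ij + β_j − β_i`.  So the cohomology class … is well-defined»).
[cite: Hartshorne2010, §6 proof of Thm. 6.2 (b)] -/
theorem cechCochain_translate (χ : ∀ α, I α →ₗ[A α] A α ⧸ I α) (α β : ι) :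
    cechCochain 𝔄 (fun γ ↦ isLift_translate (𝔄.thick γ) (hT γ) (χ γ)) α β =
      cechCochain 𝔄 hT α β + resR 𝔄 hT α β (χ β) - resL 𝔄 hT α β (χ α) := by
  have hTl := 𝔄.liftsl α β (hT α)
  have hTr := 𝔄.liftsr α β (hT β)
  have el := map_translate (𝔄.thick α) (𝔄.thick₂ α β) (𝔄.homl α β) (𝔄.liftsl α β) (hT α) (hT α) (χ α)
  have er := map_translate (𝔄.thick β) (𝔄.thick₂ α β) (𝔄.homr α β) (𝔄.liftsr α β) (hT β) (hT β) (χ β)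
  rw [cechCochain, IsLift.diff_congr (𝔄.thick₂ α β)
    (𝔄.liftsl α β (isLift_translate (𝔄.thick α) (hT α) (χ α)))
    (𝔄.liftsr α β (isLift_translate (𝔄.thick β) (hT β) (χ β))) (isLift_translate (𝔄.thick₂ α β) hTl _)
    (isLift_translate (𝔄.thick₂ α β) hTr _) el er, diff_translate_translate (𝔄.thick₂ α β) hTl hTr, cechCochain,
    resR, resL]

section Cocycle

variable {W' : Type u''} {W : Type v''} [CommRing W'] [CommRing W] {πW : W' →+* W} {eW : W'} {IW : Ideal W}

/-- **The Čech cochain is a 1-COCYCLE.**  Triple-overlap data for charts `α, β, γ`: a flat first-order thickening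
`π_W : W' ↠ W` (the thickened `U_αβγ`) with ideal `I_W`, and lift-preserving morphisms of thickenings
`κ₁ : A'_αβ → W'`, `κ₂ : A'_βγ → W'`, `κ₃ : A'_αγ → W'` compatible with the chart restrictions
(`κ₁ ρˡ_αβ = κ₃ ρˡ_αγ` on `A'_α`, `κ₁ ρʳ_αβ = κ₂ ρˡ_βγ` on `A'_β`, `κ₂ ρʳ_βγ = κ₃ ρʳ_αγ` on `A'_γ`).  Then
`c_αβ|_W + c_βγ|_W = c_αγ|_W` («on `U_ijk` … since by (a) the set of extensions is a torsor, `α_ik = α_ij + α_jk`»).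
[cite: Hartshorne2010, §6 proof of Thm. 6.2 (b)] -/
theorem cechCochain_cocycle (hW : IsFirstOrderThickening πW eW) {α β γ : ι}
    {κ₁ : A'₂ α β →+* W'} {k₁ : A₂ α β →+* W} {κ₂ : A'₂ β γ →+* W'} {k₂ : A₂ β γ →+* W}
    {κ₃ : A'₂ α γ →+* W'} {k₃ : A₂ α γ →+* W}
    (h₁ : IsThickeningHom (π₂ α β) (e₂ α β) πW eW κ₁ k₁) (h₂ : IsThickeningHom (π₂ β γ) (e₂ β γ) πW eW κ₂ k₂)
    (h₃ : IsThickeningHom (π₂ α γ) (e₂ α γ) πW eW κ₃ k₃)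
    (P₁ : PreservesLifts (π₂ α β) (e₂ α β) πW eW κ₁ (I₂ α β) IW)
    (P₂ : PreservesLifts (π₂ β γ) (e₂ β γ) πW eW κ₂ (I₂ β γ) IW)
    (P₃ : PreservesLifts (π₂ α γ) (e₂ α γ) πW eW κ₃ (I₂ α γ) IW)
    (cα : κ₁.comp (ρl α β) = κ₃.comp (ρl α γ)) (cβ : κ₁.comp (ρr α β) = κ₂.comp (ρl β γ))
    (cγ : κ₂.comp (ρr β γ) = κ₃.comp (ρr α γ)) :
    resNormal (𝔄.thick₂ α β) hW P₁ (𝔄.liftsl α β (hT α)) (cechCochain 𝔄 hT α β) +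
        resNormal (𝔄.thick₂ β γ) hW P₂ (𝔄.liftsl β γ (hT β)) (cechCochain 𝔄 hT β γ) =
      resNormal (𝔄.thick₂ α γ) hW P₃ (𝔄.liftsl α γ (hT α)) (cechCochain 𝔄 hT α γ) := by
  -- the three restricted cochains are the pairwise differences of the three lifts `T_α|_W, T_β|_W, T_γ|_W`
  have hα : IsLift πW eW IW ((T α).map (κ₃.comp (ρl α γ))) := (𝔄.liftsl α γ).comp P₃ (hT α)
  have hβ : IsLift πW eW IW ((T β).map (κ₁.comp (ρr α β))) := (𝔄.liftsr α β).comp P₁ (hT β)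
  have hγ : IsLift πW eW IW ((T γ).map (κ₃.comp (ρr α γ))) := (𝔄.liftsr α γ).comp P₃ (hT γ)
  rw [cechCochain, cechCochain, cechCochain,
    ← diff_map_eq_resNormal (𝔄.thick₂ α β) hW h₁ P₁ (𝔄.liftsl α β (hT α)) (𝔄.liftsl α β (hT α))
      (𝔄.liftsr α β (hT β)),
    ← diff_map_eq_resNormal (𝔄.thick₂ β γ) hW h₂ P₂ (𝔄.liftsl β γ (hT β)) (𝔄.liftsl β γ (hT β))
      (𝔄.liftsr β γ (hT γ)),
    ← diff_map_eq_resNormal (𝔄.thick₂ α γ) hW h₃ P₃ (𝔄.liftsl α γ (hT α)) (𝔄.liftsl α γ (hT α))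
      (𝔄.liftsr α γ (hT γ)),
    IsLift.diff_congr hW (P₁ (𝔄.liftsl α β (hT α))) (P₁ (𝔄.liftsr α β (hT β))) hα hβ
      (by rw [Ideal.map_map, cα]) (by rw [Ideal.map_map]),
    IsLift.diff_congr hW (P₂ (𝔄.liftsl β γ (hT β))) (P₂ (𝔄.liftsr β γ (hT γ))) hβ hγ
      (by rw [Ideal.map_map, cβ]) (by rw [Ideal.map_map, cγ]),
    IsLift.diff_congr hW (P₃ (𝔄.liftsl α γ (hT α))) (P₃ (𝔄.liftsr α γ (hT γ))) hα hγ
      (by rw [Ideal.map_map]) (by rw [Ideal.map_map]), add_comm,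
    hα.diff_add_diff hW hβ hγ]

end Cocycle

/-! ### §4 Given one lift of `Z`, the lifts of `Z` form a torsor under the Čech 0-cocycles `Ȟ⁰(𝔘, 𝒩)` -/

/-- **Translating a lift of `Z` by a Čech 0-cocycle** `ψ` (`ψ_α|_{αβ} = ψ_β|_{αβ}`, a global section of `𝒩`) gives a
lift of `Z` («the action of `H⁰(Y₀, 𝒩₀ ⊗ J)` … glues together … to give a global action»). [cite: Hartshorne2010,
§6 Thm. 6.2 (a)/(b)] -/
theorem IsAtlasLift.translate {K : ∀ α, Ideal (A' α)} (hK : IsAtlasLift π e ρl ρr I K)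
    (ψ : ∀ α, I α →ₗ[A α] A α ⧸ I α) (hψ : ∀ α β, resL 𝔄 hT α β (ψ α) = resR 𝔄 hT α β (ψ β)) :
    IsAtlasLift π e ρl ρr I fun α ↦ translate (π α) (e α) (K α) (I α) (ψ α) where
  isLift α := isLift_translate (𝔄.thick α) (hK.isLift α) (ψ α)
  compat α β := by
    have h := hψ α β
    rw [resL, resR] at h
    rw [map_translate (𝔄.thick α) (𝔄.thick₂ α β) (𝔄.homl α β) (𝔄.liftsl α β) (hT α) (hK.isLift α),
      map_translate (𝔄.thick β) (𝔄.thick₂ α β) (𝔄.homr α β) (𝔄.liftsr α β) (hT β) (hK.isLift β), h,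
      hK.compat α β]

/-- **The difference of two lifts of `Z` is a Čech 0-cocycle**: `(K'_α − K_α)|_{αβ} = (K'_β − K_β)|_{αβ}`.
[cite: Hartshorne2010, §6 Thm. 6.2 (a)/(b)] -/
theorem IsAtlasLift.diff_cocycle {K K' : ∀ α, Ideal (A' α)} (hK : IsAtlasLift π e ρl ρr I K)
    (hK' : IsAtlasLift π e ρl ρr I K') (α β : ι) :
    resL 𝔄 hT α β ((hK.isLift α).diff (𝔄.thick α) (hK'.isLift α)) =
      resR 𝔄 hT α β ((hK.isLift β).diff (𝔄.thick β) (hK'.isLift β)) := by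
  rw [resL, resR, ← diff_map_eq_resNormal (𝔄.thick α) (𝔄.thick₂ α β) (𝔄.homl α β) (𝔄.liftsl α β) (hT α)
      (hK.isLift α) (hK'.isLift α), ← diff_map_eq_resNormal (𝔄.thick β) (𝔄.thick₂ α β) (𝔄.homr α β)
      (𝔄.liftsr α β) (hT β) (hK.isLift β) (hK'.isLift β)]
  exact IsLift.diff_congr (𝔄.thick₂ α β) (𝔄.liftsl α β (hK.isLift α)) (𝔄.liftsl α β (hK'.isLift α))
    (𝔄.liftsr α β (hK.isLift β)) (𝔄.liftsr α β (hK'.isLift β)) (hK.compat α β) (hK'.compat α β)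

/-- **TORSOR THEOREM (Thm. 6.2 (b), last sentence, atlas form).**  If one lift `K` of `Z` to the thickened atlas exists,
then `K' ↦ (K'_α − K_α)_α` and `ψ ↦ (K_α + ψ_α)_α` are inverse bijections between the lifts of `Z` and the Čech
0-cocycles `{ψ : ψ_α|_{αβ} = ψ_β|_{αβ}}` (= `H⁰(Z, 𝒩)` for the cover) — «the set of all such is a torsor under
`H⁰(Y₀, 𝒩₀ ⊗ J)`». [cite: Hartshorne2010, §6 Thm. 6.2 (b)] -/
noncomputable def atlasLiftEquiv {K : ∀ α, Ideal (A' α)} (hK : IsAtlasLift π e ρl ρr I K) :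
    {K' : ∀ α, Ideal (A' α) // IsAtlasLift π e ρl ρr I K'} ≃
      {ψ : ∀ α, I α →ₗ[A α] A α ⧸ I α // ∀ α β, resL 𝔄 hT α β (ψ α) = resR 𝔄 hT α β (ψ β)} where
  toFun K' := ⟨fun α ↦ (hK.isLift α).diff (𝔄.thick α) (K'.2.isLift α), hK.diff_cocycle 𝔄 hT K'.2⟩
  invFun ψ := ⟨fun α ↦ EmbeddedDeformation.translate (π α) (e α) (K α) (I α) (ψ.1 α), hK.translate 𝔄 hT ψ.1 ψ.2⟩
  left_inv K' := Subtype.ext (funext fun α ↦ translate_diff (𝔄.thick α) (hK.isLift α) (K'.2.isLift α))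
  right_inv ψ := Subtype.ext (funext fun α ↦ diff_translate (𝔄.thick α) (hK.isLift α) (ψ.1 α))

/-- Uniqueness form: two lifts of `Z` whose difference 0-cocycle vanishes chart by chart are equal (with `Ȟ⁰ = 0` the
lift is unique — cf. Hartshorne Ex. 6.2.2). [cite: Hartshorne2010, §6 Thm. 6.2 (b)] -/
theorem IsAtlasLift.eq_of_diff_eq_zero {K K' : ∀ α, Ideal (A' α)} (hK : IsAtlasLift π e ρl ρr I K)
    (hK' : IsAtlasLift π e ρl ρr I K') (h : ∀ α, (hK.isLift α).diff (𝔄.thick α) (hK'.isLift α) = 0) : K' = K :=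
  funext fun α ↦ (hK.isLift α).eq_of_diff_eq_zero (𝔄.thick α) (hK'.isLift α) (h α)

end Atlas

/-! ### §5 The hypotheses are inhabited: one chart and one basic open form a thickened atlas -/

section Single

variable {R' : Type u} {R : Type v} [CommRing R'] [CommRing R] {π : R' →+* R} {e : R'}
variable (T : Submonoid R') (R'ₜ : Type u') [CommRing R'ₜ] [Algebra R' R'ₜ] [IsLocalization T R'ₜ]
variable (Rₜ : Type v') [CommRing Rₜ] [Algebra R Rₜ] [IsLocalization (T.map π) Rₜ]

/-- **Non-vacuity (the degenerate instance).**  ANY flat first-order thickening `π : R' ↠ R`, ideal `I ⊆ R` and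
submonoid `T ⊆ R'` give a thickened atlas with one chart (indexed by `Unit`) whose self-overlap is the basic open
`Spec R'_T`, both restrictions being the localisation maps (`…Restriction`: `isThickeningHom_localization`,
`preservesLifts_localization`).  Genuine atlases (several charts, twisted right restrictions) are assembled from the same
dischargers together with `preservesLifts_ringEquiv_comp_localization`. [folklore] -/
theorem thickenedAtlas_single (hT : IsFirstOrderThickening π e) (I : Ideal R) :
    ThickenedAtlas (ι := Unit) (fun _ ↦ π) (fun _ ↦ e) (fun _ _ ↦ locMap π T R'ₜ Rₜ) (fun _ _ ↦ algebraMap R' R'ₜ e)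
      (fun _ _ ↦ algebraMap R' R'ₜ) (fun _ _ ↦ algebraMap R Rₜ) (fun _ _ ↦ algebraMap R' R'ₜ)
      (fun _ _ ↦ algebraMap R Rₜ) (fun _ ↦ I) (fun _ _ ↦ I.map (algebraMap R Rₜ)) where
  thick _ := hT
  thick₂ _ _ := hT.localization T R'ₜ Rₜ
  homl _ _ := isThickeningHom_localization T R'ₜ Rₜ
  homr _ _ := isThickeningHom_localization T R'ₜ Rₜ
  liftsl _ _ := preservesLifts_localization T R'ₜ Rₜ I
  liftsr _ _ := preservesLifts_localization T R'ₜ Rₜ I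

/-- … and in that instance a lift of `Z` to the atlas is just a flat lift of `I` (the compatibility is trivial), so
both sides of `exists_isAtlasLift_iff` are inhabited as soon as one local lift exists. [folklore] -/
theorem isAtlasLift_single {I : Ideal R} {K : Ideal R'} (hK : IsLift π e I K) :
    IsAtlasLift (ι := Unit) (A'₂ := fun _ _ ↦ R'ₜ) (fun _ ↦ π) (fun _ ↦ e) (fun _ _ ↦ algebraMap R' R'ₜ)
      (fun _ _ ↦ algebraMap R' R'ₜ) (fun _ ↦ I) fun _ ↦ K where
  isLift _ := hK
  compat _ _ := rfl

end Single

end EmbeddedDeformation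

end Summit.Ventures.HSemireg
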